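import Literature.NumberTheory.PAdicHodge.DeRhamOfPeriodHoms
import Literature.NumberTheory.PAdicHodge.DeRhamEllipticBaseChange
import Literature.NumberTheory.PAdicHodge.AinfWeierstrassPeriodsLinear
import Literature.NumberTheory.PAdicHodge.AinfWeierstrassTateModuleSupersingular
import HarnessLib

/-!
# `V_pE` is de Rham at good SUPERSINGULAR reduction, from the two `p`-adic periods on `T_pÊ(𝒪_{ℂ_F})`

Topic `Literature/NumberTheory/PAdicHodge`; namespace `Literature.NumberTheory.PAdicHodge`. THEOREMS ONLY (no definition,
no named fact, no instance, no `sorry`).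

This is the SOCKET of the road "hDR via Fontaine's/Colmez's `p`-adic periods" (Fontaine 1982 §5, Colmez 1992 §2): it plugs
the tree's period homomorphisms on the Tate module `TatePt F p W = T_pŴ(𝒪_{ℂ_F})` of the formal group of an integral
Weierstrass equation `W/ℤ`,
* `AinfTop.omegaPeriodHom` (`τ ↦ ∫_τ ω = log_W([τ]) ∈ Fil¹ B_dR⁺`, `Γ_F`-equivariant, `ℤ_p`-linear:
  `omegaPeriodHom_mem_filOne`, `gal_omegaPeriodHom`, `omegaPeriodHom_smul'`),
* `AinfTop.etaPeriodHom` (`τ ↦ ∫_τ η`, `Γ_F`-equivariant, `ℤ_p`-linear, and `∫_τ η ∉ Fil¹ B_dR⁺` as soon as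
  `R_p(τ₁) ∉ p𝒪_{ℂ_F}`: `gal_etaPeriodHom`, `etaPeriodHom_smul'`, `etaPeriodHom_not_mem_filOne`),
through the matching `AinfTop.tateGeomEquivTatePtSS : T_pE(F̄) ≃ T_pŴ(𝒪_{ℂ_F})` (unconditional at an odd prime of good
supersingular reduction, `Γ_F`-equivariant: `tateGeomEquivTatePtSS_galois`) and the embedding `B_dR⁺(F) ⊆ B_dR(F) = Frac B_dR⁺(F)`
into the criterion `isDeRham_rationalTateRep_of_periodHoms` (file `DeRhamOfPeriodHoms`). Result:

* §1 bridge `BdRPlusTop F p → (bdRPeriodRingData hp).B`: Galois compatibility (`smul_algebraMap_bdR_of_symm`), `Fil¹ B_dR⁺ ↦ Fil¹ B_dR`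
  and conversely (`algebraMap_mem_fil_one_iff`), and the scalar dictionary `(c : ℚ_p) • y = qpToBdR(c) · y` GIVEN that the
  `ℚ_p`-algebra structure of `F` is the canonical one (`halg : algebraMap ℚ_[p] F = LocalField.padicRingHom F p hp`; the tree's
  `embBdRHom_algebraMap`).
* §2 **`isDeRham_rationalTateRep_curveF_of_tatePtPeriods`**: for `W/ℤ`, an odd prime `p` with `p ∤ Δ_W` and Hasse invariant
  `A_p(W mod p) = 0` (good SUPERSINGULAR reduction), a `p`-adic field `F` with its canonical `ℚ_p`-algebra structure, and
  Fontaine's `bdRPeriodRingData hp`: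
  `GaloisRep.IsDeRham (bdRPeriodRingData hp) (rationalTateRep (curveF F W) p)` **follows from the two non-degeneracy witnesses**
  (N1) `∃ τ, ∫_τ ω ≠ 0` and (Nη) `∃ τ, R_p(τ₁) ∉ p𝒪_{ℂ_F}` — the remaining analytic inputs of the road (Tate 1967 §4 / the
  "η-Hasse invariant", memo `Lines/kato-lever-hDR-sector-iii-eta.md` §8–9 of BSD route EdixhovenFibreFiveSeven, crux K★).
  With `isDeRham_restrictedRationalTateRep_iff_baseChange` this is hDR for every `E/K₀` (`K₀ ⊆ F`) having a `ℤ`-model with good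
  supersingular reduction at `p`, modulo (N1), (Nη). NOT covered: ramified coefficient models (K★'s additive cells need the good
  model over `𝒪_{F'}`, road item (R1)), `p = 2`, and the universality over ALL `ℚ_p`-algebra structures on `F` (a ring map
  `ℚ_p → F` is automatically the canonical one — separate file). BSD is not proved by any of this; the cite-only fact
  `isDeRham_restrictedRationalTateRep` stays cite-only.

## References
* [Fontaine1982FormesDifferentielles] J.-M. Fontaine, Invent. Math. 65 (1982), §5.
* [Colmez1992PeriodesAbeliennes] P. Colmez, *Périodes p-adiques des variétés abéliennes*, Math. Ann. 292 (1992), §2.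
* [FontaineAsterisque223III] J.-M. Fontaine, Astérisque 223 (1994), Exp. II §1.5, Exp. III §1.5.
* [Tate1967] J. Tate, *p-divisible groups* (1967), §4.
-/

noncomputable section

open scoped TensorProduct

namespace Literature.NumberTheory.PAdicHodge

open Literature Literature.NumberTheory.GaloisRepresentations Literature.NumberTheory.EllipticCurves WeierstrassCurve
open Literature.NumberTheory.GaloisRepresentations.IsNonarchimedeanLocalField Field ValuativeRel
open Literature.NumberTheory.GaloisRepresentations.LubinTate

variable {F : Type} [Field F] [ValuativeRel F] [TopologicalSpace F] [IsNonarchimedeanLocalField F] [CharZero F]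
  {p : ℕ} [Fact p.Prime] [Fact (¬ IsUnit (p : integerC F))] [IsAdicComplete (Ideal.span {(p : integerC F)}) (integerC F)]
  (hp : valuation F p < 1) [Algebra ℚ_[p] F]

/-! ## §1 The bridge `B_dR⁺(F) → B_dR(F) = (bdRPeriodRingData hp).B` -/

omit [Algebra ℚ_[p] F] in
/-- **`Fil¹ B_dR⁺ = B_dR⁺ ∩ Fil¹ B_dR`**: for `y ∈ B_dR⁺`, its image in `B_dR = (bdRPeriodRingData hp).B` lies in
`Fil¹ B_dR = ξ·B_dR⁺` iff `y ∈ (ξ) = Fil¹ B_dR⁺` (`B_dR⁺ → B_dR` is injective). [cite: FontaineAsterisque223III, Exp. II §1.5.5] -/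
theorem algebraMap_mem_fil_one_iff [Algebra ℚ_[p] F] (y : BdRPlusTop F p) :
    algebraMap (BDeRhamPlus (integerC F) p) (FracBdR F p) ((BdRPlusTop.of F p).symm y) ∈
        (bdRPeriodRingData (F := F) (p := p) hp).fil 1 ↔
      y ∈ (BdRPlusTop.filOne F p).toIdeal := by
  have hF := surjective_fontaineTheta_integerC hp
  haveI : IsDomain (BDeRhamPlus (integerC F) p) := isDomain_bDeRhamPlus hF
  letI : Algebra F (FracBdR F p) := fracAlgebra hp hF
  rw [BdRPlusTop.mem_filOne_iff, Ideal.mem_span_singleton']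
  change algebraMap (BDeRhamPlus (integerC F) p) (FracBdR F p) ((BdRPlusTop.of F p).symm y) ∈ fil hp hF 1 ↔ _
  rw [mem_fil_iff]
  constructor
  · rintro ⟨b, hb⟩
    refine ⟨b, algebraMap_fracBdR_injective (F := F) (p := p) ?_⟩
    rw [hb, zpow_one, map_mul, mul_comm]
  · rintro ⟨b, hb⟩
    exact ⟨b, by rw [← hb, zpow_one, map_mul, mul_comm]⟩

/-! ## §2 `V_pE` is de Rham at an odd prime of good supersingular reduction, modulo the two non-degeneracy witnesses -/

/-- **hDR at good SUPERSINGULAR reduction from the TatePt periods.** Let `W/ℤ` be an integral Weierstrass equation, `p` an odd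
prime with `p ∤ Δ_W` and Hasse invariant `A_p(W mod p) = 0`, `F` a `p`-adic field with ANY `ℚ_p`-algebra structure (it is the
canonical one: tree `LocalField.ringHom_padic_ext`), `E = curveF F W` the curve over `F`. If some `τ ∈ T_pŴ(𝒪_{ℂ_F})` has `∫_τ ω ≠ 0` (N1) and some `τ` has
`R_p(τ₁) ∉ p𝒪_{ℂ_F}` (Nη, whence `∫_τ η ∉ Fil¹`), then `V_pE` is de Rham for Fontaine's `bdRPeriodRingData hp`:
the maps `φ₁ = ∫ω ∘ e`, `φ₂ = ∫η ∘ e` (`e = tateGeomEquivTatePtSS : T_pE ≃ T_pŴ(𝒪_{ℂ_F})`), read in `B_dR ⊇ B_dR⁺`, are additive,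
`ℤ_p`-homogeneous (`omegaPeriodHom_smul'`, tree `embBdRHom_algebraMap_padic`), `Γ_F`-equivariant (`tateGeomEquivTatePtSS_galois`,
`gal_omegaPeriodHom`), `φ₁ ∈ Fil¹` (`omegaPeriodHom_mem_filOne`), `φ₂ ∉ Fil¹` somewhere (`etaPeriodHom_not_mem_filOne`), so
`isDeRham_rationalTateRep_of_periodHoms` applies. BSD is not proved by this; (N1), (Nη) and the ramified-coefficient version (R1)
remain. [cite: Fontaine1982FormesDifferentielles, §5] [cite: Colmez1992PeriodesAbeliennes, §2] [cite: Tate1967, §4] -/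
theorem isDeRham_rationalTateRep_curveF_of_tatePtPeriods (W : WeierstrassCurve ℤ) [(AinfTop.curveF F W).IsElliptic]
    (hp2 : p ≠ 2) (hΔ : ¬ (p : ℤ) ∣ W.Δ)
    (hA : (W.map (Int.castRingHom (ZMod p))).hasseCoeff p = 0)
    (hN1 : ∃ τ : AinfTop.TatePt F p W, AinfTop.omegaPeriodHom W (surjective_fontaineTheta_integerC hp) τ ≠ 0)
    (hNη : ∃ τ : AinfTop.TatePt F p W, AinfTop.mulDefectC W p (AinfTop.seq W τ 1) ∉ Ideal.span {(p : CBall F)}) :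
    GaloisRep.IsDeRham (bdRPeriodRingData (F := F) (p := p) hp) (rationalTateRep (AinfTop.curveF F W) p) := by
  have hF := surjective_fontaineTheta_integerC hp
  have hpC : ‖(p : CompletedAlgClosure F)‖ < 1 := norm_natCast_C_lt_one'
  -- rigidity: the `ℚ_p`-algebra structure of `F` is the canonical one (tree `LocalField.ringHom_padic_ext`)
  have halg : ∀ c : ℚ_[p], algebraMap ℚ_[p] F c = LocalField.padicRingHom F p hp c := fun c =>
    RingHom.congr_fun (LocalField.ringHom_padic_ext _ _) c
  -- the matching, the embedding `B_dR⁺ → B_dR`, and the two period functionals on `T_pE`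
  let e : (AinfTop.curveF F W).tateModule p ≃ₗ[ℤ_[p]] AinfTop.TatePt F p W :=
    AinfTop.tateGeomEquivTatePtSS F W p hpC hp2 hΔ hA
  let ιB : BdRPlusTop F p →+* (bdRPeriodRingData (F := F) (p := p) hp).B :=
    (algebraMap (BDeRhamPlus (integerC F) p) (FracBdR F p)).comp (BdRPlusTop.of F p).symm.toRingHom
  have hιB : ∀ y, ιB y = algebraMap (BDeRhamPlus (integerC F) p) (FracBdR F p) ((BdRPlusTop.of F p).symm y) :=
    fun _ => rfl
  let φ₁ : (AinfTop.curveF F W).tateModule p →+ (bdRPeriodRingData (F := F) (p := p) hp).B :=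
    ιB.toAddMonoidHom.comp ((AinfTop.omegaPeriodHom W hF).comp e.toAddMonoidHom)
  let φ₂ : (AinfTop.curveF F W).tateModule p →+ (bdRPeriodRingData (F := F) (p := p) hp).B :=
    ιB.toAddMonoidHom.comp ((AinfTop.etaPeriodHom W hF).comp e.toAddMonoidHom)
  have hφ₁ : ∀ a, φ₁ a = ιB (AinfTop.omegaPeriodHom W hF (e a)) := fun _ => rfl
  have hφ₂ : ∀ a, φ₂ a = ιB (AinfTop.etaPeriodHom W hF (e a)) := fun _ => rfl
  -- dictionary: scalars, Galois, the matching
  have hsc : ∀ (c : ℤ_[p]) (y : BdRPlusTop F p),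
      ιB (BdRPlusTop.of F p (qpToBdR (c : ℚ_[p])) * y) = (c : ℚ_[p]) • ιB y := fun c y => by
    rw [map_mul, Algebra.smul_def, PeriodRingData.algebraMap_eq]
    congr 1
    change algebraMap (BDeRhamPlus (integerC F) p) (FracBdR F p) (qpToBdR (c : ℚ_[p])) =
      algebraMap (BDeRhamPlus (integerC F) p) (FracBdR F p) (embBdRHom hp hF (algebraMap ℚ_[p] F c))
    rw [embBdRHom_algebraMap_padic hp hF halg]
  have hgal : ∀ (σ : absoluteGaloisGroup F) (y : BdRPlusTop F p), ιB (BdRPlusTop.gal F p σ y) = σ • ιB y := fun σ y => by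
    change _ = σ • algebraMap (BDeRhamPlus (integerC F) p) (FracBdR F p) ((BdRPlusTop.of F p).symm y)
    rw [smul_algebraMap_fracBdR]
    rfl
  have he : ∀ (σ : absoluteGaloisGroup F) (a : (AinfTop.curveF F W).tateModule p), e (σ • a) = σ • e a := fun σ a => by
    have h := AinfTop.tateGeomEquivTatePtSS_galois W p hpC hp2 hΔ hA σ a
    rwa [WeierstrassCurve.galoisRepTate_apply_apply, AinfTop.tatePtRep_apply_apply] at h
  -- feed the criterion
  refine isDeRham_rationalTateRep_of_periodHoms hp (AinfTop.curveF F W) φ₁ φ₂ (fun c a => ?_) (fun c a => ?_)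
    (fun σ a => ?_) (fun σ a => ?_) (fun a => ?_) ?_ ?_
  · rw [hφ₁, hφ₁, LinearEquiv.map_smul, AinfTop.omegaPeriodHom_smul', hsc]
  · rw [hφ₂, hφ₂, LinearEquiv.map_smul, AinfTop.etaPeriodHom_smul', hsc]
  · rw [hφ₁, hφ₁, he, ← AinfTop.gal_omegaPeriodHom, hgal]
  · rw [hφ₂, hφ₂, he, ← AinfTop.gal_etaPeriodHom, hgal]
  · rw [hφ₁, hιB]
    exact (algebraMap_mem_fil_one_iff hp _).2 (AinfTop.omegaPeriodHom_mem_filOne W _)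
  · obtain ⟨τ, hτ⟩ := hN1
    refine ⟨e.symm τ, fun h0 => hτ ?_⟩
    rw [hφ₁, LinearEquiv.apply_symm_apply, hιB] at h0
    have h1 := algebraMap_fracBdR_injective (F := F) (p := p) (h0.trans (map_zero _).symm)
    exact (BdRPlusTop.of F p).symm.injective (h1.trans (map_zero _).symm)
  · obtain ⟨τ, hτ⟩ := hNη
    refine ⟨e.symm τ, fun h => AinfTop.etaPeriodHom_not_mem_filOne W (hθ := hF) τ hτ
      ((algebraMap_mem_fil_one_iff hp (AinfTop.etaPeriodHom W hF τ)).1 ?_)⟩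
    rwa [hφ₂, LinearEquiv.apply_symm_apply, hιB] at h

omit [ValuativeRel F] [TopologicalSpace F] [IsNonarchimedeanLocalField F] [Fact (¬ IsUnit (p : integerC F))]
  [IsAdicComplete (Ideal.span {(p : integerC F)}) (integerC F)] [Algebra ℚ_[p] F] in
/-- The curve `curveF F W = W ×_ℤ F` of an integral equation with `Δ_W ≠ 0` is elliptic (`char F = 0`; Silverman, AEC III.§1,
`Δ ≠ 0` ⟺ nonsingular). [cite: SilvermanAEC2009, Prop. III.1.4] -/
theorem AinfTop.isElliptic_curveF_of_ne_zero (W : WeierstrassCurve ℤ) (hΔ : W.Δ ≠ 0) : (AinfTop.curveF F W).IsElliptic := by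
  refine ⟨?_⟩
  rw [WeierstrassCurve.map_Δ]
  exact (Ne.isUnit (Int.cast_ne_zero.mpr hΔ))

/-- **hDR for a curve over a subfield `K₀ ⊆ F` whose base change to `F` is `W ×_ℤ F`** (`W/ℤ` with good supersingular reduction
at the odd prime `p`), in the literal currency `restrictedRationalTateRep` of the cite-only fact `isDeRham_restrictedRationalTateRep`,
modulo the witnesses (N1), (Nη): `isDeRham_rationalTateRep_curveF_of_tatePtPeriods` transported along the tree's
`isDeRham_restrictedRationalTateRep_iff_baseChange`. (E.g. `K₀ = ℚ`, `W₀ = W ×_ℤ ℚ`, `F = ℚ_p` or any `p`-adic field.) BSD is not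
proved by this. [cite: Fontaine1982FormesDifferentielles, §5] [cite: Colmez1992PeriodesAbeliennes, §2] -/
theorem isDeRham_restrictedRationalTateRep_of_tatePtPeriods {K₀ : Type} [Field K₀] [CharZero K₀] [Algebra K₀ F]
    (W₀ : WeierstrassCurve K₀) [W₀.IsElliptic] (W : WeierstrassCurve ℤ) (hW : W₀.baseChange F = AinfTop.curveF F W)
    (hp2 : p ≠ 2) (hΔ : ¬ (p : ℤ) ∣ W.Δ) (hA : (W.map (Int.castRingHom (ZMod p))).hasseCoeff p = 0)
    (hN1 : ∃ τ : AinfTop.TatePt F p W, AinfTop.omegaPeriodHom W (surjective_fontaineTheta_integerC hp) τ ≠ 0)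
    (hNη : ∃ τ : AinfTop.TatePt F p W, AinfTop.mulDefectC W p (AinfTop.seq W τ 1) ∉ Ideal.span {(p : CBall F)}) :
    GaloisRep.IsDeRham (bdRPeriodRingData (F := F) (p := p) hp) (restrictedRationalTateRep W₀ F p) := by
  rw [isDeRham_restrictedRationalTateRep_iff_baseChange hp W₀]
  have key : ∀ (E : WeierstrassCurve F) [E.IsElliptic], E = AinfTop.curveF F W →
      GaloisRep.IsDeRham (bdRPeriodRingData (F := F) (p := p) hp) (rationalTateRep E p) := by
    intro E _ hE
    subst hE
    exact isDeRham_rationalTateRep_curveF_of_tatePtPeriods hp W hp2 hΔ hA hN1 hNη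
  exact key _ hW

end Literature.NumberTheory.PAdicHodge

end
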